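import Literature.Topology.Immersions.DoublePointsGenericity
import Literature.Topology.Immersions.ProjectionFieldBundle
import Literature.Topology.FourManifolds.SmoothOrientation
import Literature.Geometry.Manifold.StabilityOfEmbeddings
import Mathlib.LinearAlgebra.Orientation
import HarnessLib

/-!
# Zeros of a transverse section: finiteness and signs (the Euler number of a section)

Topic `Literature/Topology/Immersions`. For a rank-`n` projection-field bundle `E = E(P)` over a
compact `n`-manifold `M` and a `C^∞` map `s : M → ℝᵐ` whose zeros are **transverse**
(at every zero `x`, `v ↦ P_x(ds_x v)` is onto `E_x`; generic by `ProjBundleGenericSection.lean`):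

* `ProjBundle.finite_zeros_of_transverse` — the zero set of any `C^∞` `s : M → ℝᵐ` with
  transverse zeros is finite (closed in compact `M`, and
  isolated: `x ↦ leftInv(A_{x₀})(s x)` has bijective differential at a transverse zero `x₀`,
  hence is injective near `x₀`, by the tree's local stability of immersions);
* `ProjBundle.vertDiff`, `ProjBundle.bijective_vertDiff` — the vertical differential
  `E'_x : ℝⁿ → E_x`, bijective at a transverse zero;
* `ProjBundle.zeroSign oM o s x ∈ {±1}` — `+1` iff `E'_x` carries the orientation `oM x` of
  `T_x M` (a `SmoothOrientation`, read in the preferred chart) to the fibre orientation `o x`;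
  `0` at a non-transverse point; `zeroSign_neg`;
* `ProjBundle.eulerNumberOfSection` — the signed count of zeros (Milnor–Stasheff §9, §11
  Thm. 11.17 / Bott–Tu Thm. 11.16: for an oriented rank-`n` bundle over a closed oriented
  `n`-manifold this is `⟨e(E), [M]⟩`; Kirby, *The Topology of 4-Manifolds* (1989), Ch. II
  p. 22 and Ch. VI: `χ(ν)` "is the algebraic number of zeros of a section").

The independence of the count from the section (the Euler NUMBER of the bundle) is not proved
in this file. Everything here is proved; the definitions are data; no named facts.

## References

* J. Milnor, J. Stasheff, *Characteristic Classes* (1974), §9, §11. [MilnorStasheff1974]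
* R. C. Kirby, *The Topology of 4-Manifolds*, LNM 1374 (1989), Ch. II, Ch. VI. [Kirby1989]
-/

open scoped Manifold ContDiff Topology
open Set Function Module Filter

noncomputable section

namespace Literature.Topology.Immersions

/-- Local notation: `𝔼 n` is the model Euclidean space `EuclideanSpace ℝ (Fin n)`. -/
local notation "𝔼 " n:arg => EuclideanSpace ℝ (Fin n)

open Literature.Topology.FourManifolds (SmoothOrientation leftInv leftInv_injOn)
open Literature.Geometry.Manifold (exists_isOpen_eventually_injOn_and_injective_mfderiv)

namespace ProjBundle

variable {n m : ℕ} {M : Type*} [TopologicalSpace M] [ChartedSpace (𝔼 n) M]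

/-! ### The vertical differential at a zero -/

/-- **The vertical differential** `v ↦ P_x (ds_x v) : ℝⁿ → E_x` of `s` at `x` (meaningful at a
zero of the section `P s`). [folklore] -/
def vertDiff (P : ProjBundle n m n M) (s : M → 𝔼 m) (x : M) : 𝔼 n →ₗ[ℝ] P.fibre x :=
  LinearMap.codRestrict (P.fibre x) ((P.proj x).toLinearMap ∘ₗ (ediff n m s x).toLinearMap)
    fun _ => P.proj_mem_fibre x _

/-- The vertical differential, as a vector of `ℝᵐ`. [folklore] -/
@[simp] theorem vertDiff_apply (P : ProjBundle n m n M) (s : M → 𝔼 m) (x : M) (v : 𝔼 n) :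
    (P.vertDiff s x v : 𝔼 m) = P.proj x (ediff n m s x v) := rfl

/-- **At a transverse point the vertical differential is bijective** (onto by transversality,
injective by the dimension count `dim E_x = n`). [folklore] -/
theorem bijective_vertDiff (P : ProjBundle n m n M) (s : M → 𝔼 m) (x : M)
    (htr : ∀ w ∈ P.fibre x, ∃ v : 𝔼 n, P.proj x (ediff n m s x v) = w) :
    Bijective (P.vertDiff s x) := by
  have hsurj : Surjective (P.vertDiff s x) := by
    rintro ⟨w, hw⟩
    obtain ⟨v, hv⟩ := htr w hw
    exact ⟨v, Subtype.ext hv⟩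
  refine ⟨(LinearMap.injective_iff_surjective_of_finrank_eq_finrank ?_).2 hsurj, hsurj⟩
  rw [finrank_euclideanSpace_fin]
  exact (P.finrank_range x).symm

/-! ### Finiteness of the zero set -/

/-- **The zeros of a transverse section over a compact base are finite.**
[cite: MilnorStasheff1974, §11; Kirby1989, Ch. II p. 22] -/
theorem finite_zeros_of_transverse [T2Space M] [SecondCountableTopology M] [CompactSpace M]
    [IsManifold (𝓡 n) ∞ M] (P : ProjBundle n m n M) {s : M → 𝔼 m}
    (hs : ContMDiff (𝓡 n) (𝓡 m) ∞ s)
    (htr : ∀ x, s x = 0 → ∀ w ∈ P.fibre x, ∃ v : 𝔼 n, P.proj x (ediff n m s x v) = w) :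
    Set.Finite {x : M | s x = 0} := by
  haveI : LocallyCompactSpace M := ChartedSpace.locallyCompactSpace (𝔼 n) M
  set T : Set M := {x | s x = 0}
  have hTc : IsClosed T := isClosed_eq hs.continuous continuous_const
  have hTK : IsCompact T := hTc.isCompact
  -- each zero is isolated: `x ↦ leftInv(A₀)(s x)` is injective near a transverse zero `x₀`
  have hiso : ∀ x₀ ∈ T, ∃ N : Set M, IsOpen N ∧ x₀ ∈ N ∧ ∀ x ∈ N, x ∈ T → x = x₀ := by
    intro x₀ hx₀
    let L₀ : 𝔼 m →L[ℝ] 𝔼 n := leftInv (P.frameAt x₀ x₀)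
    let G : M → 𝔼 n := fun x => L₀ (s x)
    have hG : ContMDiff (𝓡 n) (𝓡 n) ∞ G := L₀.contDiff.comp_contMDiff hs
    have hsd : MDifferentiableAt (𝓡 n) (𝓡 m) s x₀ := (hs x₀).mdifferentiableAt (by simp)
    -- `dG_{x₀} v = L₀ (ds v) = L₀ (P (ds v))`, onto `ℝⁿ`
    have hdG : ∀ v : 𝔼 n, mfderiv (𝓡 n) (𝓡 n) G x₀ v = L₀ (ediff n m s x₀ v) := by
      intro v
      have hcomp : G = (L₀ : 𝔼 m → 𝔼 n) ∘ s := rfl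
      rw [hcomp, mfderiv_comp x₀ (g := (L₀ : 𝔼 m → 𝔼 n)) (f := s) L₀.mdifferentiableAt hsd,
        ContinuousLinearMap.mfderiv_eq]
      rfl
    have hsurjG : Surjective (mfderiv (𝓡 n) (𝓡 n) G x₀) := by
      intro u
      -- `u = leftInv(A₀) w` for `w = A₀ u ∈ E_{x₀}`; pick `v` with `P (ds v) = w`
      have hgood := P.mem_goodSet_self x₀
      obtain ⟨v, hv⟩ := htr x₀ hx₀ (P.frameAt x₀ x₀ u) (P.frameAt_apply_mem x₀ x₀ u)
      refine ⟨v, ?_⟩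
      rw [hdG, ← P.leftInv_frameAt_proj x₀ x₀, hv]
      exact Literature.Topology.FourManifolds.leftInv_apply_self hgood.2 u
    have hinjG : Injective (mfderiv (𝓡 n) (𝓡 n) G x₀) := by
      obtain ⟨A, hA, hAi⟩ : ∃ A : 𝔼 n →ₗ[ℝ] 𝔼 n, Surjective A ∧
          (Injective A → Injective (mfderiv (𝓡 n) (𝓡 n) G x₀)) :=
        ⟨(mfderiv (𝓡 n) (𝓡 n) G x₀).toLinearMap, hsurjG, fun h => h⟩
      exact hAi ((LinearMap.injective_iff_surjective_of_finrank_eq_finrank rfl).2 hA)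
    have hΦ : ContMDiffOn (𝓘(ℝ, ℝ).prod (𝓡 n)) 𝓘(ℝ, 𝔼 n) ∞
        (uncurry fun (_ : ℝ) (x : M) => G x) ((univ : Set ℝ) ×ˢ (univ : Set M)) :=
      (hG.comp contMDiff_snd).contMDiffOn
    obtain ⟨N, hNo, hpN, hev⟩ := exists_isOpen_eventually_injOn_and_injective_mfderiv
      (J := 𝓘(ℝ, ℝ)) (I := 𝓡 n) (n := ∞) isOpen_univ hΦ (by simp) (mem_univ (0 : ℝ)) x₀ hinjG
    have hinjN : InjOn G N := (hev.self_of_nhds).1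
    refine ⟨N, hNo, hpN, fun x hx hxT => hinjN hx hpN ?_⟩
    have h1 : s x = 0 := hxT
    have h2 : s x₀ = 0 := hx₀
    show L₀ (s x) = L₀ (s x₀)
    rw [h1, h2]
  -- compact with isolated points, hence finite
  choose! N hNo hpN hNuniq using hiso
  obtain ⟨F, hFT, hFfin, hcover⟩ := hTK.elim_finite_subcover_image (b := T) (c := N)
    (fun p hp => hNo p hp) (fun p hp => mem_biUnion hp (hpN p hp))
  refine hFfin.subset fun p hp => ?_
  obtain ⟨p₀, hp₀F, hpp₀⟩ := mem_iUnion₂.1 (hcover hp)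
  rw [hNuniq p₀ (hFT hp₀F) p hpp₀ hp]
  exact hp₀F

/-! ### Signs of zeros and the Euler number of a section -/

/-- **The sign of a transverse zero**: `+1` if the vertical differential `ℝⁿ → E_x` carries the
orientation `oM x` of `T_x M` (read in the preferred chart at `x`) to the fibre orientation
`o x`, `-1` if to its opposite, and `0` if the point is not transverse.
[cite: MilnorStasheff1974, §11; Kirby1989, Ch. II p. 22] -/
def zeroSign (P : ProjBundle n m n M) (oM : M → Orientation ℝ (𝔼 n) (Fin (finrank ℝ (𝔼 n))))
    (o : ∀ x, Orientation ℝ (P.fibre x) (Fin n)) (s : M → 𝔼 m) (x : M) : ℤ := by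
  classical
  exact if h : Bijective (P.vertDiff s x) then
    (if Orientation.map (Fin n) (LinearEquiv.ofBijective (P.vertDiff s x) h)
        (Orientation.reindex ℝ (𝔼 n) (finCongr finrank_euclideanSpace_fin) (oM x)) = o x
      then 1 else -1)
  else 0

/-- At a non-transverse point the sign is `0`. [folklore] -/
theorem zeroSign_of_not_bijective (P : ProjBundle n m n M)
    (oM : M → Orientation ℝ (𝔼 n) (Fin (finrank ℝ (𝔼 n))))
    (o : ∀ x, Orientation ℝ (P.fibre x) (Fin n)) (s : M → 𝔼 m) {x : M}
    (h : ¬ Bijective (P.vertDiff s x)) : P.zeroSign oM o s x = 0 := by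
  classical
  unfold zeroSign
  rw [dif_neg h]

/-- At a transverse point the sign is `±1`. [folklore] -/
theorem zeroSign_eq_one_or_eq_neg_one (P : ProjBundle n m n M)
    (oM : M → Orientation ℝ (𝔼 n) (Fin (finrank ℝ (𝔼 n))))
    (o : ∀ x, Orientation ℝ (P.fibre x) (Fin n)) (s : M → 𝔼 m) {x : M}
    (h : Bijective (P.vertDiff s x)) : P.zeroSign oM o s x = 1 ∨ P.zeroSign oM o s x = -1 := by
  classical
  unfold zeroSign
  rw [dif_pos h]
  split_ifs
  · exact Or.inl rfl
  · exact Or.inr rfl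

/-- **Reversing the fibre orientations reverses every sign.** [folklore] -/
theorem zeroSign_neg (P : ProjBundle n m n M)
    (oM : M → Orientation ℝ (𝔼 n) (Fin (finrank ℝ (𝔼 n))))
    (o : ∀ x, Orientation ℝ (P.fibre x) (Fin n)) (s : M → 𝔼 m) (x : M) :
    P.zeroSign oM (fun y => -o y) s x = -P.zeroSign oM o s x := by
  classical
  unfold zeroSign
  by_cases h : Bijective (P.vertDiff s x)
  · rw [dif_pos h, dif_pos h]
    have hcard : Fintype.card (Fin n) = finrank ℝ (P.fibre x) := by
      rw [Fintype.card_fin]; exact (P.finrank_range x).symm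
    set a := Orientation.map (Fin n) (LinearEquiv.ofBijective (P.vertDiff s x) h)
        (Orientation.reindex ℝ (𝔼 n) (finCongr finrank_euclideanSpace_fin) (oM x))
    by_cases ha : a = o x
    · rw [if_pos ha, if_neg]
      · rw [ha]
        exact Module.Ray.ne_neg_self (o x)
    · rw [if_neg ha, if_pos]
      · norm_num
      · rcases a.eq_or_eq_neg (o x) hcard with h1 | h1
        · exact absurd h1 ha
        · exact h1
  · rw [dif_neg h, dif_neg h]
    norm_num

/-- **The Euler number of a section**: the signed count of its (finitely many) zeros.
[cite: MilnorStasheff1974, §11 Thm. 11.17; Kirby1989, Ch. II p. 22] -/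
def eulerNumberOfSection (P : ProjBundle n m n M)
    (oM : M → Orientation ℝ (𝔼 n) (Fin (finrank ℝ (𝔼 n))))
    (o : ∀ x, Orientation ℝ (P.fibre x) (Fin n)) (s : M → 𝔼 m)
    (hfin : Set.Finite {x : M | s x = 0}) : ℤ :=
  ∑ x ∈ hfin.toFinset, P.zeroSign oM o s x

/-- Reversing the fibre orientations reverses the Euler number of a section. [folklore] -/
theorem eulerNumberOfSection_neg (P : ProjBundle n m n M)
    (oM : M → Orientation ℝ (𝔼 n) (Fin (finrank ℝ (𝔼 n))))
    (o : ∀ x, Orientation ℝ (P.fibre x) (Fin n)) (s : M → 𝔼 m)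
    (hfin : Set.Finite {x : M | s x = 0}) :
    P.eulerNumberOfSection oM (fun y => -o y) s hfin = -P.eulerNumberOfSection oM o s hfin := by
  unfold eulerNumberOfSection
  rw [← Finset.sum_neg_distrib]
  exact Finset.sum_congr rfl fun x _ => P.zeroSign_neg oM o s x

/-- A section without zeros has Euler number `0`. [folklore] -/
theorem eulerNumberOfSection_eq_zero_of_forall_ne (P : ProjBundle n m n M)
    (oM : M → Orientation ℝ (𝔼 n) (Fin (finrank ℝ (𝔼 n))))
    (o : ∀ x, Orientation ℝ (P.fibre x) (Fin n)) (s : M → 𝔼 m)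
    (hfin : Set.Finite {x : M | s x = 0}) (h : ∀ x, s x ≠ 0) :
    P.eulerNumberOfSection oM o s hfin = 0 := by
  unfold eulerNumberOfSection
  have : hfin.toFinset = ∅ := by
    ext x
    simp [h x]
  rw [this, Finset.sum_empty]

end ProjBundle

end Literature.Topology.Immersions
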